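import Literature.Topology.FourManifolds.RegularFibreMorsePerturbation
import Literature.Topology.FourManifolds.SimplifiedBrokenLefschetzHemispheres
import Literature.Topology.FourManifolds.SimplifiedBrokenLefschetzRoundCritical
import HarnessLib

/-!
# Baykur's Euler characteristic formula for simplified broken Lefschetz fibrations:
# `χ(X) = 6 - 4g + k` (non-empty round locus), by a global Morse function

Topic `Literature/Topology/FourManifolds`.  Baykur 2012, Lemma 7, verbatim: *"If `X` admits a
genus `g` SBLF with `k` Lefschetz singularities, then `e(X) = 4 - 4g + k` if round locus is
empty, and `e(X) = 6 - 4g + k`, otherwise."*  This file PROVES the second identity for every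
closed 4-manifold `X` (Hausdorff, second countable, compact, `C^∞`) carrying an SBLF
`IsSimplifiedBrokenLefschetzFibration o f L h` (genus `g = h + 1`, non-empty round locus,
Lefschetz set `L`, `k = #L`), with `e(X)` the tree's `relEuler ℤ ℤ X ∅`:
`IsSimplifiedBrokenLefschetzFibration.relEuler_eq_six_sub_four_mul_add_card` — the general form recorded as a TODO under
the named fact `card_eq_four_mul_of_sblf_of_homotopyEquiv_sphere_four` of
`SimplifiedBrokenLefschetzFibration.lean` (its homotopy-4-sphere case `k = 4h`, discharged in
`SimplifiedBrokenLefschetzEulerCount.lean` by a slab-and-caps Mayer–Vietoris count, follows at once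
from `e(X) = 2`).  Everything here is **proved**; there are no definitions and no named facts.

## The proof (Morse theory of ONE height function on the closed manifold)

Baykur's three-line proof decomposes `X` into `D² × Σ_{g-1}`, a round cobordism of Euler
characteristic `0`, and a genus-`g` Lefschetz fibration over `D²` (`= D² × Σ_g` plus `k`
2-handles), so that `e(X) = (2 - 2(g-1)) + 0 + (2 - 2g) + k`.  We realise the same count with
one Morse function on `X` (Milnor 1963, Thm. 5.2 in the tree's form
`SphereMorseCount.morseCount_eq_relEuler`: `Σ_k (-1)^k c_k = χ(X)`):

1. normalise the round image to the equator `E = {y₂ = 0}` of `S²`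
   (`IsSimplifiedBrokenLefschetzFibration.exists_image_round_eq_sphereEquator`);
2. take the height `ℓ = ⟪a, ·⟫`, `a = (s, 0, 1)` with `s ∈ (0, 1)` generic (the poles `±a/‖a‖`
   and `±a'/‖a'‖`, `a' = (-s, 0, 1)`, are not Lefschetz values), and `g₀ = ℓ ∘ f`;
3. `g₀` is Morse away from the two pole fibres: Lefschetz points are nondegenerate of index `2`
   (`isMCriticalPt_nondegenerate_morseIndex_comp_of_lefschetzChart`), the round critical points
   are the finitely many round points over `(±1, 0, 0)`, nondegenerate
   (`SimplifiedBrokenLefschetzRoundCritical.lean`), and regular points of `f` are critical only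
   over the poles;
4. the pole fibres (Morse–Bott critical submanifolds) are removed by two fibrewise Morse
   perturbations (`exists_morsePerturbation_near_regularFibre`,
   `RegularFibreMorsePerturbation.lean`), contributing `(-1)² χ(F₊) + (-1)⁰ χ(F₋)` to the count,
   where `F±` are the fibres over the two poles, of genera `{h + 1, h}`
   (`IsSimplifiedBrokenLefschetzFibration.exists_hemisphere_ranks`: the genus is constant over
   each open hemisphere off the Lefschetz values);
5. hence `χ(X) = k + ρ(a) + (2 - 2g₊) + (2 - 2g₋)` with `ρ(a)` the signed count of the round
   critical points (`IsSimplifiedBrokenLefschetzFibration.morseCount_height_comp`); the same for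
   `a'` with `ρ(a') = -ρ(a)` (the indices at each round critical point have opposite parity,
   `nondegenerate_and_odd_morseIndex_add_of_round`), and adding the two identities gives
   `2χ(X) = 2k + 2(4 - (4h + 2))`, i.e. `χ(X) = 6 - 4(h + 1) + k`.

## References

* R. İ. Baykur, *Broken Lefschetz fibrations and smooth structures on 4-manifolds*, Geom. Topol.
  Monogr. 18 (2012), Lemma 7. [Baykur2012]
* J. Milnor, *Morse theory* (1963), §2, §3, Thm. 5.2. [Milnor1963]
* K. Hayano, *On genus-1 simplified broken Lefschetz fibrations*, Algebr. Geom. Topol. 11 (2011),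
  Def. 2.1. [Hayano2011]
-/

noncomputable section

open scoped Manifold ContDiff Topology RealInnerProductSpace
open Set Function Filter Metric
open Literature.AlgebraicTopology.SingularHomology

namespace Literature.Topology.FourManifolds

universe u

/-! ### Parity bookkeeping -/

/-- `(-1)^m + (-1)^n = 0` when `m + n` is odd. [folklore] -/
theorem neg_one_pow_add_neg_one_pow_eq_zero_of_odd {m n : ℕ} (h : Odd (m + n)) :
    (-1 : ℤ) ^ m + (-1) ^ n = 0 := by
  have hprod : (-1 : ℤ) ^ m * (-1) ^ n = -1 := by rw [← pow_add]; exact h.neg_one_pow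
  rcases neg_one_pow_eq_or ℤ n with hn | hn <;> rw [hn] at hprod ⊢ <;> linarith

namespace IsSimplifiedBrokenLefschetzFibration

open SphereHeight

variable {X : Type u} [TopologicalSpace X] [T2Space X] [SecondCountableTopology X]
  [CompactSpace X] [ChartedSpace (EuclideanSpace ℝ (Fin 4)) X] [IsManifold (𝓡 4) ∞ X]
  {o : SmoothOrientation (𝓡 4) X} {f : X → (Metric.sphere (0 : EuclideanSpace ℝ (Fin 3)) 1)}
  {L : Finset X} {h : ℕ}

/-! ### The Morse count for one height function -/

/-- **The Morse count of a (perturbed) height function composed with an SBLF** (steps 3–5 of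
the module docstring; Baykur 2012, proof of Lemma 7, in Morse-theoretic form).  For an SBLF
`f : X → S²` on a closed 4-manifold with equatorial round image, fibre ranks
`r₊, r₋` over the two open hemispheres off the Lefschetz values
(`exists_hemisphere_ranks`), and a direction `a = (a₀, 0, a₂)`, `a₀ ≠ 0 < a₂`, whose poles
`±a/‖a‖` are not Lefschetz values:
`#L + Σ_{q round, (f q)₁ = 0} (-1)^{ind_q (⟪a,·⟫ ∘ f)} + (2 - r₊) + (2 - r₋) = χ(X)`.
[cite: Baykur2012, Lemma 7] [cite: Milnor1963, Thm. 5.2] -/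
theorem morseCount_height_comp (hf : IsSimplifiedBrokenLefschetzFibration o f L h)
    (hround : f '' ({p : X | ¬ Surjective (mfderiv (𝓡 4) (𝓡 2) f p)} \ (↑L : Set X)) =
      sphereEquator 1)
    {rp rm : ℕ}
    (hrp : ∀ y : (Metric.sphere (0 : EuclideanSpace ℝ (Fin 3)) 1), 0 < (y : EuclideanSpace ℝ (Fin 3)) 2 →
      y ∉ f '' (↑L : Set X) →
      (∀ q, f q = y → Surjective (mfderiv (𝓡 4) (𝓡 2) f q)) ∧
        Nonempty ((Fin rp → ℤ) ≃ₗ[ℤ] singularHomology ℤ ℤ ↥(f ⁻¹' {y}) 1))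
    (hrm : ∀ y : (Metric.sphere (0 : EuclideanSpace ℝ (Fin 3)) 1), (y : EuclideanSpace ℝ (Fin 3)) 2 < 0 →
      y ∉ f '' (↑L : Set X) →
      (∀ q, f q = y → Surjective (mfderiv (𝓡 4) (𝓡 2) f q)) ∧
        Nonempty ((Fin rm → ℤ) ≃ₗ[ℤ] singularHomology ℤ ℤ ↥(f ⁻¹' {y}) 1))
    {a : EuclideanSpace ℝ (Fin 3)} (ha : a ≠ 0) (ha1 : a 1 = 0) (ha0 : a 0 ≠ 0) (ha2 : 0 < a 2)
    (htop : top ha ∉ f '' (↑L : Set X)) (hbot : bot ha ∉ f '' (↑L : Set X))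
    {R : Finset X} (hR : ∀ q, q ∈ R ↔ ¬ Surjective (mfderiv (𝓡 4) (𝓡 2) f q) ∧ q ∉ L ∧
      ((f q : Metric.sphere (0 : EuclideanSpace ℝ (Fin 3)) 1) : EuclideanSpace ℝ (Fin 3)) 1 = 0) :
    (L.card : ℤ) + ∑ q ∈ R, (-1 : ℤ) ^ morseIndex (𝓡 4) (height a ∘ f) q +
      ((2 : ℤ) - rp) + ((2 : ℤ) - rm) = relEuler ℤ ℤ X ∅ := by
  classical
  have hℓs : ContMDiff (𝓡 2) 𝓘(ℝ, ℝ) ∞ (height a) := contMDiff_height a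
  have hM : IsMorse (𝓡 2) (height a) := isMorse_height ha
  -- the poles
  have hnorm : 0 < ‖a‖⁻¹ := inv_pos.2 (norm_pos_iff.2 ha)
  have htop2 : 0 < ((top ha : Metric.sphere (0 : EuclideanSpace ℝ (Fin 3)) 1) : EuclideanSpace ℝ (Fin 3)) 2 := by
    show 0 < (‖a‖⁻¹ • a) 2
    rw [PiLp.smul_apply, smul_eq_mul]; exact mul_pos hnorm ha2
  have hbot2 : ((bot ha : Metric.sphere (0 : EuclideanSpace ℝ (Fin 3)) 1) : EuclideanSpace ℝ (Fin 3)) 2 < 0 := by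
    show (-(‖a‖⁻¹ • a)) 2 < 0
    rw [PiLp.neg_apply, PiLp.smul_apply, smul_eq_mul, neg_lt_zero]; exact mul_pos hnorm ha2
  obtain ⟨htop_reg, ⟨ltop⟩⟩ := hrp _ htop2 htop
  obtain ⟨hbot_reg, ⟨lbot⟩⟩ := hrm _ hbot2 hbot
  have hcrit_top : IsMCriticalPt (𝓡 2) (height a) (top ha) := by
    have : top ha ∈ criticalSet (𝓡 2) (height a) := by
      rw [criticalSet_height ha]; exact mem_insert _ _
    exact this
  have hcrit_bot : IsMCriticalPt (𝓡 2) (height a) (bot ha) := by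
    have : bot ha ∈ criticalSet (𝓡 2) (height a) := by
      rw [criticalSet_height ha]; exact mem_insert_of_mem _ (mem_singleton _)
    exact this
  have hℓcrit : ∀ y, IsMCriticalPt (𝓡 2) (height a) y → y = top ha ∨ y = bot ha := fun y hy => by
    have : y ∈ criticalSet (𝓡 2) (height a) := hy
    rw [criticalSet_height ha] at this
    simpa using this
  have hnd_top : (mhessian (𝓡 2) (height a) (top ha)).Nondegenerate := hM.nondegenerate hcrit_top
  have hnd_bot : (mhessian (𝓡 2) (height a) (bot ha)).Nondegenerate := hM.nondegenerate hcrit_bot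
  have hind_top : morseIndex (𝓡 2) (height a) (top ha) = 2 := (morseIndex_top_eq ha).1
  have hind_bot : morseIndex (𝓡 2) (height a) (bot ha) = 0 := (morseIndex_top_eq ha).2
  -- the regular values and the two polar regions
  set O : Set (Metric.sphere (0 : EuclideanSpace ℝ (Fin 3)) 1) :=
    {y | ∀ q, f q = y → Surjective (mfderiv (𝓡 4) (𝓡 2) f q)} with hO
  have hOo : IsOpen O := hf.isOpen_setOf_regularValue
  have hc2 : Continuous fun y : (Metric.sphere (0 : EuclideanSpace ℝ (Fin 3)) 1) =>
      (y : EuclideanSpace ℝ (Fin 3)) 2 :=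
    (EuclideanSpace.proj (2 : Fin 3)).continuous.comp continuous_subtype_val
  set O₁ : Set (Metric.sphere (0 : EuclideanSpace ℝ (Fin 3)) 1) :=
    O ∩ {y | 0 < (y : EuclideanSpace ℝ (Fin 3)) 2} with hO₁
  set O₂ : Set (Metric.sphere (0 : EuclideanSpace ℝ (Fin 3)) 1) :=
    O ∩ {y | (y : EuclideanSpace ℝ (Fin 3)) 2 < 0} with hO₂
  have hO₁o : IsOpen O₁ := hOo.inter (isOpen_lt continuous_const hc2)
  have hO₂o : IsOpen O₂ := hOo.inter (isOpen_lt hc2 continuous_const)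
  have htopO₁ : top ha ∈ O₁ := ⟨htop_reg, htop2⟩
  have hbotO₂ : bot ha ∈ O₂ := ⟨hbot_reg, hbot2⟩
  have hsub₁ : ∀ x, f x ∈ O₁ → Surjective (mfderiv (𝓡 4) (𝓡 2) f x) := fun x hx => hx.1 x rfl
  have hsub₂ : ∀ x, f x ∈ O₂ → Surjective (mfderiv (𝓡 4) (𝓡 2) f x) := fun x hx => hx.1 x rfl
  have hLO : ∀ x ∈ L, f x ∉ O := fun x hx hO' => hf.not_surjective_mfderiv_of_mem hx (hO' x rfl)
  have hZO : ∀ x, ¬ Surjective (mfderiv (𝓡 4) (𝓡 2) f x) → f x ∉ O := fun x hx hO' => hx (hO' x rfl)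
  -- the two pole fibres as embedded surfaces
  obtain ⟨Sp, _, _, _, _, _, _, _, ep, hep, hep_range⟩ :=
    hf.exists_isSmoothEmbedding_range_eq_fibre htop_reg
  obtain ⟨Sm, _, _, _, _, _, _, _, em, hem, hem_range⟩ :=
    hf.exists_isSmoothEmbedding_range_eq_fibre hbot_reg
  haveI : Nonempty Sp := by
    obtain ⟨x, hx⟩ := hf.surjective (top ha)
    have : x ∈ range ep := by rw [hep_range]; exact hx
    exact ⟨this.choose⟩
  haveI : Nonempty Sm := by
    obtain ⟨x, hx⟩ := hf.surjective (bot ha)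
    have : x ∈ range em := by rw [hem_range]; exact hx
    exact ⟨this.choose⟩
  -- the first perturbation, near the fibre over the top
  obtain ⟨K₁, g₁, -, hK₁O, htopK, hg₁s, hg₁eq, hg₁nd, C₁, hC₁, hsum₁⟩ :=
    exists_morsePerturbation_near_regularFibre hf.contMDiff hO₁o htopO₁ hsub₁ hℓs hcrit_top
      hnd_top (g := height a ∘ f) (hℓs.comp hf.contMDiff) (fun x _ => rfl) hep hep_range
  -- the second perturbation, near the fibre over the bottom
  have hg₁ℓ : ∀ x, f x ∈ O₂ → g₁ x = (height a) (f x) := fun x hx => by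
    have hxK : f x ∉ K₁ := fun hK => by
      have h₁ : 0 < ((f x : Metric.sphere (0 : EuclideanSpace ℝ (Fin 3)) 1) : EuclideanSpace ℝ (Fin 3)) 2 :=
        (hK₁O hK).2
      have h₂ : ((f x : Metric.sphere (0 : EuclideanSpace ℝ (Fin 3)) 1) : EuclideanSpace ℝ (Fin 3)) 2 < 0 := hx.2
      exact absurd h₁ (not_lt.2 h₂.le)
    exact (hg₁eq x hxK).eq_of_nhds
  obtain ⟨K₂, g₂, -, hK₂O, hbotK, hg₂s, hg₂eq, hg₂nd, C₂, hC₂, hsum₂⟩ :=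
    exists_morsePerturbation_near_regularFibre hf.contMDiff hO₂o hbotO₂ hsub₂ hℓs hcrit_bot
      hnd_bot hg₁s hg₁ℓ hem hem_range
  -- positions of the critical values
  have hK12 : ∀ y, y ∈ K₁ → y ∉ K₂ := fun y h1 h2 => by
    have h₁ : 0 < ((y : Metric.sphere (0 : EuclideanSpace ℝ (Fin 3)) 1) : EuclideanSpace ℝ (Fin 3)) 2 :=
      (hK₁O h1).2
    have h₂ : ((y : Metric.sphere (0 : EuclideanSpace ℝ (Fin 3)) 1) : EuclideanSpace ℝ (Fin 3)) 2 < 0 :=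
      (hK₂O h2).2
    exact absurd h₁ (not_lt.2 h₂.le)
  have hLK₁ : ∀ x ∈ L, f x ∉ K₁ := fun x hx hK => hLO x hx (hK₁O hK).1
  have hLK₂ : ∀ x ∈ L, f x ∉ K₂ := fun x hx hK => hLO x hx (hK₂O hK).1
  have hZK₁ : ∀ x, ¬ Surjective (mfderiv (𝓡 4) (𝓡 2) f x) → f x ∉ K₁ := fun x hx hK =>
    hZO x hx (hK₁O hK).1
  have hZK₂ : ∀ x, ¬ Surjective (mfderiv (𝓡 4) (𝓡 2) f x) → f x ∉ K₂ := fun x hx hK =>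
    hZO x hx (hK₂O hK).1
  -- germ transports `g₂ ~ g₁` off `K₂`, `g₁ ~ g₀` off `K₁`
  have hT₂ : ∀ x, f x ∉ K₂ → (IsMCriticalPt (𝓡 4) g₂ x ↔ IsMCriticalPt (𝓡 4) g₁ x) ∧
      ((mhessian (𝓡 4) g₂ x).Nondegenerate ↔ (mhessian (𝓡 4) g₁ x).Nondegenerate) ∧
      morseIndex (𝓡 4) g₂ x = morseIndex (𝓡 4) g₁ x := fun x hx =>
    morseData_congr_of_eventuallyEq (I := 𝓡 4) (hg₂eq x hx)
  have hT₁ : ∀ x, f x ∉ K₁ → (IsMCriticalPt (𝓡 4) g₁ x ↔ IsMCriticalPt (𝓡 4) (height a ∘ f) x) ∧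
      ((mhessian (𝓡 4) g₁ x).Nondegenerate ↔ (mhessian (𝓡 4) (height a ∘ f) x).Nondegenerate) ∧
      morseIndex (𝓡 4) g₁ x = morseIndex (𝓡 4) (height a ∘ f) x := fun x hx =>
    morseData_congr_of_eventuallyEq (I := 𝓡 4) (hg₁eq x hx)
  -- `g₀ = height a ∘ f` at Lefschetz points: nondegenerate of index `2`
  have hLef : ∀ x ∈ L, IsMCriticalPt (𝓡 4) (height a ∘ f) x ∧
      (mhessian (𝓡 4) (height a ∘ f) x).Nondegenerate ∧ morseIndex (𝓡 4) (height a ∘ f) x = 2 := by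
    intro x hx
    obtain ⟨c, -⟩ := hf.lefschetz x hx
    refine isMCriticalPt_nondegenerate_morseIndex_comp_of_lefschetzChart c hf.contMDiff hℓs ?_
    intro h0
    rcases hℓcrit (f x) h0 with h1 | h1
    · exact htop ⟨x, by simpa using hx, h1⟩
    · exact hbot ⟨x, by simpa using hx, h1⟩
  -- `g₀` at round points: critical iff `(f x)₁ = 0`, then nondegenerate
  have hRd : ∀ x, ¬ Surjective (mfderiv (𝓡 4) (𝓡 2) f x) → x ∉ L →
      (IsMCriticalPt (𝓡 4) (height a ∘ f) x ↔
        ((f x : Metric.sphere (0 : EuclideanSpace ℝ (Fin 3)) 1) : EuclideanSpace ℝ (Fin 3)) 1 = 0) :=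
    fun x hxs hxL => hf.isMCriticalPt_height_comp_iff_of_round hround hxs hxL ha1 ha0
  have hRnd : ∀ x, ¬ Surjective (mfderiv (𝓡 4) (𝓡 2) f x) → x ∉ L →
      ((f x : Metric.sphere (0 : EuclideanSpace ℝ (Fin 3)) 1) : EuclideanSpace ℝ (Fin 3)) 1 = 0 →
      (mhessian (𝓡 4) (height a ∘ f) x).Nondegenerate := by
    intro x hxs hxL hx1
    -- the reflected direction `a' = (-a₀, 0, a₂)`
    set a' : EuclideanSpace ℝ (Fin 3) := a - (2 * a 0) • EuclideanSpace.single (0 : Fin 3) (1 : ℝ)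
      with ha'
    have ha'0 : a' 0 = -a 0 := by simp [ha']; ring
    have ha'1 : a' 1 = 0 := by simp [ha', ha1]
    have ha'2 : a' 2 = a 2 := by simp [ha']
    exact (hf.nondegenerate_and_odd_morseIndex_add_of_round hround hxs hxL hx1 ha1 ha'1 ha0 ha'0
      ha2.ne' ha'2).1
  -- regular points of `f` with value off `K₁ ∪ K₂` are not critical for `g₀`
  have hreg : ∀ x, Surjective (mfderiv (𝓡 4) (𝓡 2) f x) → f x ∉ K₁ → f x ∉ K₂ →
      ¬ IsMCriticalPt (𝓡 4) (height a ∘ f) x := by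
    intro x hxs h1 h2 hc
    have hfd : MDifferentiableAt (𝓡 4) (𝓡 2) f x := (hf.contMDiff x).mdifferentiableAt (by simp)
    have hℓd : MDifferentiableAt (𝓡 2) 𝓘(ℝ, ℝ) (height a) (f x) := (hℓs _).mdifferentiableAt (by simp)
    have hℓc : IsMCriticalPt (𝓡 2) (height a) (f x) :=
      (isMCriticalPt_comp_iff_of_surjective_mfderiv hfd hℓd hxs).1 hc
    rcases hℓcrit _ hℓc with h' | h'
    · exact h1 (by rw [h']; exact htopK)
    · exact h2 (by rw [h']; exact hbotK)
  -- classification of the critical points of `g₂`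
  have hclass : ∀ x, IsMCriticalPt (𝓡 4) g₂ x ↔ x ∈ C₂ ∨ x ∈ C₁ ∨ x ∈ L ∨ x ∈ R := by
    intro x
    by_cases h2 : f x ∈ K₂
    · constructor
      · intro hc; exact Or.inl ((hC₂ x).2 ⟨h2, hc⟩)
      · rintro (hx | hx | hx | hx)
        · exact ((hC₂ x).1 hx).2
        · exact absurd h2 (hK12 _ ((hC₁ x).1 hx).1)
        · exact absurd h2 (hLK₂ x hx)
        · exact absurd h2 (hZK₂ x ((hR x).1 hx).1)
    · rw [(hT₂ x h2).1]
      by_cases h1 : f x ∈ K₁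
      · constructor
        · intro hc; exact Or.inr (Or.inl ((hC₁ x).2 ⟨h1, hc⟩))
        · rintro (hx | hx | hx | hx)
          · exact absurd ((hC₂ x).1 hx).1 h2
          · exact ((hC₁ x).1 hx).2
          · exact absurd h1 (hLK₁ x hx)
          · exact absurd h1 (hZK₁ x ((hR x).1 hx).1)
      · rw [(hT₁ x h1).1]
        constructor
        · intro hc
          by_cases hxL : x ∈ L
          · exact Or.inr (Or.inr (Or.inl hxL))
          by_cases hxs : Surjective (mfderiv (𝓡 4) (𝓡 2) f x)
          · exact absurd hc (hreg x hxs h1 h2)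
          · exact Or.inr (Or.inr (Or.inr ((hR x).2 ⟨hxs, hxL, (hRd x hxs hxL).1 hc⟩)))
        · rintro (hx | hx | hx | hx)
          · exact absurd ((hC₂ x).1 hx).1 h2
          · exact absurd ((hC₁ x).1 hx).1 h1
          · exact (hLef x hx).1
          · obtain ⟨hxs, hxL, hx1⟩ := (hR x).1 hx
            exact (hRd x hxs hxL).2 hx1
  -- `g₂` is a Morse function
  have hMorse : IsMorse (𝓡 4) g₂ := by
    refine ⟨hg₂s, fun x hc => ?_⟩
    by_cases h2 : f x ∈ K₂
    · exact hg₂nd x h2 hc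
    obtain ⟨hc12, hnd12, -⟩ := hT₂ x h2
    refine hnd12.2 ?_
    have hc1 := hc12.1 hc
    by_cases h1 : f x ∈ K₁
    · exact hg₁nd x h1 hc1
    obtain ⟨hc01, hnd01, -⟩ := hT₁ x h1
    refine hnd01.2 ?_
    have hc0 := hc01.1 hc1
    by_cases hxL : x ∈ L
    · exact (hLef x hxL).2.1
    by_cases hxs : Surjective (mfderiv (𝓡 4) (𝓡 2) f x)
    · exact absurd hc0 (hreg x hxs h1 h2)
    · exact hRnd x hxs hxL ((hRd x hxs hxL).1 hc0)
  -- the critical set as a finite disjoint union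
  have hCeq : criticalSet (𝓡 4) g₂ = ↑(C₂ ∪ C₁ ∪ L ∪ R) := by
    ext x
    rw [mem_criticalSet, hclass x]
    simp only [Finset.coe_union, mem_union, Finset.mem_coe]
    tauto
  have hCfin : (criticalSet (𝓡 4) g₂).Finite := by rw [hCeq]; exact Finset.finite_toSet _
  have hfs : hCfin.toFinset = C₂ ∪ C₁ ∪ L ∪ R :=
    Finset.coe_injective (by rw [Set.Finite.coe_toFinset, hCeq])
  -- the Morse count `Σ (-1)^{ind} = χ(X) = 2`
  have hcount := SphereMorseCount.morseCount_eq_relEuler (n := 3) hMorse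
  have hN : ∀ x ∈ criticalSet (𝓡 4) g₂, morseIndex (𝓡 4) g₂ x < 3 + 2 := fun x _ => by
    have := morseIndex_le_finrank (𝓡 4) g₂ x
    rw [finrank_euclideanSpace_fin] at this
    omega
  rw [← sum_neg_one_pow_morseIndex_eq hCfin hN, hfs] at hcount
  have hd21 : Disjoint C₂ C₁ := Finset.disjoint_left.2 fun x hx2 hx1 =>
    hK12 _ ((hC₁ x).1 hx1).1 ((hC₂ x).1 hx2).1
  have hd2L : Disjoint (C₂ ∪ C₁) L := Finset.disjoint_left.2 fun x hx hxL => by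
    rcases Finset.mem_union.1 hx with hx | hx
    · exact hLK₂ x hxL ((hC₂ x).1 hx).1
    · exact hLK₁ x hxL ((hC₁ x).1 hx).1
  have hd3R : Disjoint (C₂ ∪ C₁ ∪ L) R := Finset.disjoint_left.2 fun x hx hxR => by
    obtain ⟨hxs, hxL, -⟩ := (hR x).1 hxR
    rcases Finset.mem_union.1 hx with hx | hx
    · rcases Finset.mem_union.1 hx with hx | hx
      · exact hZK₂ x hxs ((hC₂ x).1 hx).1
      · exact hZK₁ x hxs ((hC₁ x).1 hx).1
    · exact hxL hx
  rw [Finset.sum_union hd3R, Finset.sum_union hd2L, Finset.sum_union hd21] at hcount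
  -- the four partial sums
  have hs2 : ∑ x ∈ C₂, (-1 : ℤ) ^ morseIndex (𝓡 4) g₂ x = relEuler ℤ ℤ Sm ∅ := by
    rw [hsum₂, hind_bot, pow_zero, one_mul]
  have hs1 : ∑ x ∈ C₁, (-1 : ℤ) ^ morseIndex (𝓡 4) g₂ x = relEuler ℤ ℤ Sp ∅ := by
    have h1 : ∑ x ∈ C₁, (-1 : ℤ) ^ morseIndex (𝓡 4) g₂ x =
        ∑ x ∈ C₁, (-1 : ℤ) ^ morseIndex (𝓡 4) g₁ x :=
      Finset.sum_congr rfl fun x hx => by rw [(hT₂ x (hK12 _ ((hC₁ x).1 hx).1)).2.2]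
    rw [h1, hsum₁, hind_top]
    norm_num
  have hsL : ∑ x ∈ L, (-1 : ℤ) ^ morseIndex (𝓡 4) g₂ x = L.card := by
    rw [Finset.card_eq_sum_ones, Nat.cast_sum]
    refine Finset.sum_congr rfl fun x hx => ?_
    rw [(hT₂ x (hLK₂ x hx)).2.2, (hT₁ x (hLK₁ x hx)).2.2, (hLef x hx).2.2]
    norm_num
  have hsR : ∑ x ∈ R, (-1 : ℤ) ^ morseIndex (𝓡 4) g₂ x =
      ∑ x ∈ R, (-1 : ℤ) ^ morseIndex (𝓡 4) (height a ∘ f) x :=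
    Finset.sum_congr rfl fun x hx => by
      obtain ⟨hxs, -, -⟩ := (hR x).1 hx
      rw [(hT₂ x (hZK₂ x hxs)).2.2, (hT₁ x (hZK₁ x hxs)).2.2]
  rw [hs2, hs1, hsL, hsR] at hcount
  -- Euler characteristics of the pole fibres: `χ(F) = 2 - rank H₁`
  have hχp : relEuler ℤ ℤ Sp ∅ = 2 - (rp : ℤ) := by
    obtain ⟨F, _, _, _, _, _, _, _, e', φ', -, -, -, -, -, -, hχF⟩ :=
      hf.exists_oriented_surface_fibre htop_reg
    have ψ₁ : Sp ≃ₜ ↥(f ⁻¹' {top ha}) :=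
      hep.isEmbedding.toHomeomorph.trans (Homeomorph.setCongr hep_range)
    rw [relEuler_eq_of_homeomorph (A := ∅) (B := ∅) (ψ₁.trans φ'.symm) (mapsTo_empty _ _)
      (mapsTo_empty _ _), hχF,
      ← ltop.finrank_eq, Module.finrank_fin_fun]
  have hχm : relEuler ℤ ℤ Sm ∅ = 2 - (rm : ℤ) := by
    obtain ⟨F, _, _, _, _, _, _, _, e', φ', -, -, -, -, -, -, hχF⟩ :=
      hf.exists_oriented_surface_fibre hbot_reg
    have ψ₁ : Sm ≃ₜ ↥(f ⁻¹' {bot ha}) :=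
      hem.isEmbedding.toHomeomorph.trans (Homeomorph.setCongr hem_range)
    rw [relEuler_eq_of_homeomorph (A := ∅) (B := ∅) (ψ₁.trans φ'.symm) (mapsTo_empty _ _)
      (mapsTo_empty _ _), hχF,
      ← lbot.finrank_eq, Module.finrank_fin_fun]
  rw [hχp, hχm] at hcount
  linarith

/-! ### Generic directions and the Euler count -/

/-- The slope `|b₀| / |b₂|` is invariant under scaling. [folklore] -/
theorem abs_apply_zero_div_abs_apply_two_smul {c : ℝ} (hc : c ≠ 0) (b : EuclideanSpace ℝ (Fin 3)) :
    |(c • b) 0| / |(c • b) 2| = |b 0| / |b 2| := by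
  simp only [PiLp.smul_apply, smul_eq_mul, abs_mul]
  rw [mul_div_mul_left _ _ (abs_ne_zero.2 hc)]

open SphereHeight in
/-- **Baykur's Euler characteristic formula (Baykur 2012, Lemma 7, non-empty round locus):
`e(X) = 6 - 4g + k`** for every closed 4-manifold `X` carrying a genus-`g = h + 1` simplified
broken Lefschetz fibration with `k = #L` Lefschetz points — here `e(X) = relEuler ℤ ℤ X ∅`, the
Euler characteristic of the tree's singular homology.  Proof: the Morse count of the module
docstring for the two generic directions `a = (±s, 0, 1)` (`morseCount_height_comp`), whose round
contributions cancel (`nondegenerate_and_odd_morseIndex_add_of_round`), and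
`r₊ + r₋ = 2(h + 1) + 2h` (`exists_hemisphere_ranks`). [cite: Baykur2012, Lemma 7] -/
theorem relEuler_eq_six_sub_four_mul_add_card (hf : IsSimplifiedBrokenLefschetzFibration o f L h) :
    relEuler ℤ ℤ X ∅ = 6 - 4 * ((h : ℤ) + 1) + L.card := by
  classical
  -- normalise the round image to the equator
  obtain ⟨f', hf', hround⟩ := hf.exists_image_round_eq_sphereEquator
  obtain ⟨rp, rm, hsum, hrp, hrm⟩ := hf'.exists_hemisphere_ranks hround
  -- the round critical points
  set R : Finset X := (hf'.finite_round_inter_apply_one_eq_zero hround).toFinset with hRdef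
  have hR : ∀ q, q ∈ R ↔ ¬ Surjective (mfderiv (𝓡 4) (𝓡 2) f' q) ∧ q ∉ L ∧
      ((f' q : Metric.sphere (0 : EuclideanSpace ℝ (Fin 3)) 1) : EuclideanSpace ℝ (Fin 3)) 1 = 0 :=
    fun q => by rw [hRdef, Set.Finite.mem_toFinset]; rfl
  -- a generic slope `s ∈ (0, 1)`: the poles of `(±s, 0, 1)` are not Lefschetz values
  set bad : Set ℝ := (fun y : (Metric.sphere (0 : EuclideanSpace ℝ (Fin 3)) 1) =>
      |(y : EuclideanSpace ℝ (Fin 3)) 0| / |(y : EuclideanSpace ℝ (Fin 3)) 2|) '' (f' '' (↑L : Set X))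
    with hbad_def
  have hbad : bad.Finite := (L.finite_toSet.image f').image _
  obtain ⟨s, hs01, hsbad⟩ : ∃ s ∈ Set.Ioo (0 : ℝ) 1, s ∉ bad := by
    obtain ⟨s, hs, hsb⟩ := ((Set.Ioo_infinite (zero_lt_one' ℝ)).sdiff hbad).nonempty
    exact ⟨s, hs, hsb⟩
  have hs0 : 0 < s := hs01.1
  -- the two directions `a = (s, 0, 1)`, `a' = (-s, 0, 1)`
  set a : EuclideanSpace ℝ (Fin 3) :=
    EuclideanSpace.single (0 : Fin 3) s + EuclideanSpace.single (2 : Fin 3) (1 : ℝ) with ha_def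
  set a' : EuclideanSpace ℝ (Fin 3) :=
    EuclideanSpace.single (0 : Fin 3) (-s) + EuclideanSpace.single (2 : Fin 3) (1 : ℝ) with ha'_def
  have ha0 : a 0 = s := by simp [ha_def]
  have ha1 : a 1 = 0 := by simp [ha_def]
  have ha2 : a 2 = 1 := by simp [ha_def]
  have ha'0 : a' 0 = -s := by simp [ha'_def]
  have ha'1 : a' 1 = 0 := by simp [ha'_def]
  have ha'2 : a' 2 = 1 := by simp [ha'_def]
  have ha : a ≠ 0 := fun h0 => by
    have := congrArg (fun v : EuclideanSpace ℝ (Fin 3) => v 2) h0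
    simp only [ha2, PiLp.zero_apply] at this
    exact one_ne_zero this
  have ha' : a' ≠ 0 := fun h0 => by
    have := congrArg (fun v : EuclideanSpace ℝ (Fin 3) => v 2) h0
    simp only [ha'2, PiLp.zero_apply] at this
    exact one_ne_zero this
  have hpole : ∀ (b : EuclideanSpace ℝ (Fin 3)) (hb : b ≠ 0), |b 0| / |b 2| = s →
      top hb ∉ f' '' (↑L : Set X) ∧ bot hb ∉ f' '' (↑L : Set X) := by
    intro b hb hbs
    have hn : ‖b‖⁻¹ ≠ 0 := inv_ne_zero (norm_ne_zero_iff.2 hb)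
    constructor
    · intro hmem
      refine hsbad ⟨top hb, hmem, ?_⟩
      show |((‖b‖⁻¹ • b : EuclideanSpace ℝ (Fin 3))) 0| / |(‖b‖⁻¹ • b : EuclideanSpace ℝ (Fin 3)) 2| = s
      rw [abs_apply_zero_div_abs_apply_two_smul hn, hbs]
    · intro hmem
      refine hsbad ⟨bot hb, hmem, ?_⟩
      show |(-(‖b‖⁻¹ • b) : EuclideanSpace ℝ (Fin 3)) 0| / |(-(‖b‖⁻¹ • b) : EuclideanSpace ℝ (Fin 3)) 2| = s
      rw [show (-(‖b‖⁻¹ • b) : EuclideanSpace ℝ (Fin 3)) = (-‖b‖⁻¹) • b by rw [neg_smul],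
        abs_apply_zero_div_abs_apply_two_smul (neg_ne_zero.2 hn), hbs]
  obtain ⟨htop, hbot⟩ := hpole a ha (by rw [ha0, ha2, abs_one, div_one, abs_of_pos hs0])
  obtain ⟨htop', hbot'⟩ := hpole a' ha' (by rw [ha'0, ha'2, abs_one, div_one, abs_neg, abs_of_pos hs0])
  -- the two Morse counts
  have hE := hf'.morseCount_height_comp hround hrp hrm ha ha1 (by rw [ha0]; exact hs0.ne')
    (by rw [ha2]; exact one_pos) htop hbot hR
  have hE' := hf'.morseCount_height_comp hround hrp hrm ha' ha'1
    (by rw [ha'0]; exact neg_ne_zero.2 hs0.ne') (by rw [ha'2]; exact one_pos) htop' hbot' hR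
  -- the round contributions cancel
  have hcancel : ∑ q ∈ R, (-1 : ℤ) ^ morseIndex (𝓡 4) (height a ∘ f') q +
      ∑ q ∈ R, (-1 : ℤ) ^ morseIndex (𝓡 4) (height a' ∘ f') q = 0 := by
    rw [← Finset.sum_add_distrib]
    refine Finset.sum_eq_zero fun q hq => ?_
    obtain ⟨hqs, hqL, hq1⟩ := (hR q).1 hq
    exact neg_one_pow_add_neg_one_pow_eq_zero_of_odd
      (hf'.nondegenerate_and_odd_morseIndex_add_of_round hround hqs hqL hq1 ha1 ha'1
        (by rw [ha0]; exact hs0.ne') (by rw [ha'0, ha0]) (by rw [ha2]; exact one_ne_zero)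
        (by rw [ha'2, ha2])).2.2
  -- arithmetic: `2 χ(X) = 2 #L + 2 (4 - (r₊ + r₋))`, `r₊ + r₋ = 4h + 2`
  have hsumZ : (rp : ℤ) + rm = 2 * (h + 1) + 2 * h := by exact_mod_cast hsum
  linarith

end IsSimplifiedBrokenLefschetzFibration

end Literature.Topology.FourManifolds
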